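/-
Copyright: statement-level skeleton of a published paper (lit-balaban cell, Phase-2 proof seat p13, gen 8). No proof
claims beyond what the kernel checks below.
-/
import Literature.MathematicalPhysics.QuantumFieldTheory.BalabanImbrieJaffe1984to88.BIJ88TraceTerms579

/-!
# `BalabanImbrieJaffe1984to88.BIJ88TraceTermsBound579` — T. Bałaban, J. Imbrie, A. Jaffe, *Effective action and cluster
properties of the abelian Higgs model*, Commun. Math. Phys. **114** (1988) 257–315 [BalabanImbrieJaffe1988]: Sect. 5.7,
p. 291 — THE MECHANISM OF THE FIRST INEQUALITY OF (5.7.9), *"This is to account for one free summation on T₁^{(j)}; all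
but one such summation is controlled by exponential decay on the j-th scale"*: the ROOTED LINKED-CHAIN SUM and the bound
`|wlen l S X| ≤ s·|X|·(N_κ(C)N_κ(W))^l·e^{−κ|X|}` with EXACTLY ONE volume factor (file 2/3; 1/3 = `BIJ88TraceTerms579`,
3/3 = `BIJ88Ineq579First`)

statement-level skeleton of published theorems with citation tags; proofs where landed; nothing here is a claim about the Yang–Mills mass gap

PDF held: `paper:balaban1988-cmp114-bij-abelian-higgs-effective-action` (journal page = PDF page + 256); p. 291 [PDF 35]
read as an IMAGE (CCITT render `pages/original-p035-x2.png`; copy `HOME/lit-balaban-p13/pages/`).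

CITATION HEADER (lean-in-tree rule).  Part of the lit-balaban TYPED SKELETON (HOME `run/shared/lean/pub/lit-balaban/`):
WHAT IS REPRODUCED = row **C2.Eq5.7.7-5.7.9** of `HOME/lit-balaban-r16/ROWS-C2-part2.md`, member *(5.7.9), first
inequality*, its printed justification; unit `lit-balaban-p13` (gen 8), owner r16, referee ref-5.  Built BY NAME on
`BIJ88TraceTerms579` (words, hulls, `LinkedFrom`, `wlen`), r01's `B4RandomWalk213` (`bprod`, `sum_tuple_succ`) and Mathlib's
`Matrix.linfty_opNorm_def` / `Matrix.linfty_opNorm_mul`; nothing restated.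

## The print (p. 289 [PDF 33] and p. 291 [PDF 35], verbatim)

(5.7.4): *"Thus the determinant can be expanded as exp[Σ_{l=1}^{∞} (1/2l) tr(C^{(j)}_{Λ₁₀^{(j)}}(u_{k+1})W^{(j)})^l]."*
p. 289: *"The operator C^{(j)}_{Λ₁₀^{(j)}}(u_{k+1}) is our first encounter with nonlocal effects. To treat it we apply the
generalized random walk expansion (2.45), modified slightly to use cubes of size L^{k−j}r(e_k) in T_{L^{−j}}. We need a
similar expansion for W^{(j)} into terms defined in regions X with appropriate decay estimates."*  p. 291: *"In the
expansion (5.7.4) we put W^{(j)} = W^{(j,n̄)} + Σ_X W^{(j)}(X). In terms with l ≤ n̄ we separate from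
(1/2l) tr(C^{(j)}_{Λ₁₀^{(j)}}(u_{k+1})W^{(j,n̄)}) the terms of order ≤ n̄ in e_j. […] These will be treated carefully by a
resummation. In the other terms we insert the expansion for C^{(j)}_{Λ₁₀^{(j)}}(u_{k+1}); they then take the form
Σ_X W^{(j)′}(X), with  |W^{(j)′}(X)| ≤ e_j^{n̄+1−α} e^{−cr(e_k)|X|^−} (r(e_k)L^{k−j})^d |X| ≤ e_j^κ e^{−cr(e_k)|X|^−}. (5.7.9)
We can take κ arbitrarily large by increasing n̄. The high power of e_j beats the big factor (r(e_k)L^{k−j})^d, the volume of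
an elementary cube measured on the j-th scale. This is to account for one free summation on T₁^{(j)}; all but one such
summation is controlled by exponential decay on the j-th scale."*  p. 294: *"As always, X is a connected union of
L^{k−j}r(e_k)-cubes, and W^{(j)(iv)}(X) has dependence only on fields in X, X̄, or B_{k−j}(X)."*

## The typing (model instance, READING declared; shared by the three files `BIJ88TraceTerms579`,
`BIJ88TraceTermsBound579`, `BIJ88Ineq579First`)

* SITES `T` (the real coordinates of the fields on `Λ₁₀^{(j)} ⊂ T_{L^{−j}}`, as in p02's typing of (5.7.4),
  `BIJ88TraceLog574`), ELEMENTARY CUBES `ι` (*"cubes of size L^{k−j}r(e_k)"*) with the cube map `cube : T → ι`, at most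
  `s` sites per cube (print: `s = (r(e_k)L^{k−j})^d`, *"the volume of an elementary cube measured on the j-th scale"*).
* THE TWO EXPANDED OPERATORS as finite families of real kernels with cube supports: `C = Σ_a C_a` (`Cl : A → Matrix T T ℝ`,
  support `sC a : Finset ι`) — the local pieces and the `C_X` of the random walk expansion (2.45) — and `W = Σ_b W_b`
  (`Wl : B → Matrix T T ℝ`, support `sW b`) — the pieces of `W^{(j,n̄)}` and the `W^{(j)}(X)` of the block (5.7.7); SUPPORT
  means `C_a(x,y) ≠ 0 ⇒ cube x, cube y ∈ sC a` (*"G_j(Ω,X,u;x₁,x₂) = 0 unless both x₁ and x₂ are in X"*, (2.45)/(5.7.8)).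
  A WORD of length `l` is `w : Fin l → A × B`; its term in `tr((CW)^l)` is `tr(C_{a₁}W_{b₁}⋯C_{a_l}W_{b_l})` =
  `(bprod (letter Cl Wl) l w).trace` (r01's ordered product `B4RandomWalk213.bprod`); its HULL is the union of the
  supports of its letters; `wlen l S X` is the sum of the terms of the words of length `l` with hull `X` selected by a
  decidable predicate `S` (*"the other terms"*), and `W^{(j)′}(X) = Σ_{l≥1} (1/2l)·wlen l S X` (`BIJ88Ineq579First.Wprime`).
* NORMS: the `ℓ^∞`-OPERATOR norm of real matrices (max row sum; Mathlib scope `Matrix.Norms.Operator`), as in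
  `BIJ88TraceLog574` and `BIJ88Neumann5711`; the decay inputs are ROOTED SUMS over the pieces through a cube (hypotheses).

## What is kernel-checked here

* `norm_bprod_le` — `‖C_{a₁}W_{b₁}⋯C_{a_l}W_{b_l}‖ ≤ Π_i ‖C_{a_i}‖‖W_{b_i}‖` (operator norm); entries `≤` norm; `|tr K| ≤ Σ_x |K(x,x)|`.
* **`sum_linkedFrom_le`** — THE ROOTED LINKED-CHAIN SUM: for letter weights `f, g ≥ 0` with rooted sums
  `Σ_{a : c ∈ sC a} f(a)|sC a| ≤ N_C`, `Σ_{b : c ∈ sW b} g(b)|sW b| ≤ N_W` at every cube, the sum over ALL words of length `l`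
  linked from a given cube of `Π_i f(a_i)g(b_i)` is `≤ (N_C N_W)^l` — each letter after the first is summed through one of
  the cubes of the previous support (the factor `|support|`).
* **`sum_hull_linkedFrom_le`** — with `κ`-weighted rooted sums, the words with hull EXACTLY `X` carry an extra `e^{−κ|X|}`
  (`|X| ≤ Σ|supports|`).
* **`abs_wlen_le_of_majorant`**, **`abs_wlen_le`** — ONE FREE SUMMATION: `|tr K| ≤ Σ_x|K(x,x)|` roots every word at a site of
  `X`, at most `s` per cube, whence for every selection `S`, every `X`, every `κ ≥ 0`:
  `|wlen l S X| ≤ s·|X|·e^{−κ|X|}·(N_κ(C)·N_κ(W))^l`,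
  `N_κ(C) ≥ Σ_{a : c ∈ sC a} ‖C_a‖e^{κ|sC a|}|sC a|`, `N_κ(W) ≥ Σ_{b : c ∈ sW b} ‖W_b‖e^{κ|sW b|}|sW b|` — the print's single volume
  factor `(r(e_k)L^{k−j})^d|X| = s|X|`, everything else *"controlled by exponential decay"* (the rooted sums are `O(1)` resp.
  small as soon as the pieces decay like `e^{−κ′|support|}`, κ′ > κ, with boundedly many pieces per cube and size; they are
  HYPOTHESES here); **`rooted_sum_le_of_decay`** — how they are met: pieces supported in `R`-connected cube sets
  weighing in aggregate `≤ K·λ^{|X|}` per support `X` ((2.46)/(5.7.7)-type decay) have `κ`-weighted rooted sums `≤ 4Kλe^κ`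
  once `(Δ₀+1)²·2λe^κ ≤ ½` (the tree's lattice-animal bound `sum_pow_card_le_of_connected`).

HONEST SCOPE.  Letters, supports, decay are inputs in the displayed shapes; the `e_j`-orders and the sum over `l` are file
3/3.  Theorems only (four private folklore helpers); no definitions, no `Prop` facts; axioms standard.
-/

namespace Literature.MathematicalPhysics.QuantumFieldTheory.BalabanImbrieJaffe1984to88.BIJ88TraceTermsBound579

open Finset
open Literature.MathematicalPhysics.QuantumFieldTheory.Balaban1983to89.B4RandomWalk213
  (bprod bprod_zero bprod_succ bprod_cons bprod_one sum_pow_eq_sum_bprod sum_tuple_succ)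
open Literature.Probability.LatticeModels (IsRConnected)
open BIJ88TraceTerms579
open scoped Matrix Matrix.Norms.Operator

variable {T ι A B : Type*} [Fintype T] [DecidableEq T] [Fintype ι] [DecidableEq ι]
  [Fintype A] [DecidableEq A] [Fintype B] [DecidableEq B]

/-! ## §4 The mechanism: one free summation, every other one paid by a rooted sum -/

section Mechanism

variable {cube : T → ι} {Cl : A → Matrix T T ℝ} {sC : A → Finset ι} {Wl : B → Matrix T T ℝ} {sW : B → Finset ι}

/-- an entry of a real kernel is at most its `ℓ^∞`-operator norm (max row sum). [folklore] -/
private theorem abs_apply_le_norm (M : Matrix T T ℝ) (i j : T) : |M i j| ≤ ‖M‖ := by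
  rw [Matrix.linfty_opNorm_def]
  have h1 : (‖M i j‖₊ : NNReal) ≤ ∑ j', ‖M i j'‖₊ :=
    Finset.single_le_sum (f := fun j' => ‖M i j'‖₊) (fun _ _ => zero_le) (Finset.mem_univ j)
  have h2 : (∑ j', ‖M i j'‖₊ : NNReal) ≤ Finset.univ.sup fun i' => ∑ j', ‖M i' j'‖₊ :=
    Finset.le_sup (f := fun i' => ∑ j', ‖M i' j'‖₊) (Finset.mem_univ i)
  have h := NNReal.coe_le_coe.mpr (h1.trans h2)
  rw [coe_nnnorm, Real.norm_eq_abs] at h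
  exact h

omit [Fintype ι] [DecidableEq ι] [Fintype A] [DecidableEq A] [Fintype B] [DecidableEq B] in
/-- `‖C_{a₁}W_{b₁}⋯C_{a_l}W_{b_l}‖ ≤ Π_i ‖C_{a_i}‖·‖W_{b_i}‖` for `l ≥ 1` (submultiplicativity of the operator norm — *"all
but one such summation is controlled by"* the norms of the letters). [cite: BalabanImbrieJaffe1988, (5.7.9) p.291] -/
theorem norm_bprod_le : ∀ (l : ℕ) (w : Fin (l + 1) → A × B),
    ‖bprod (letter Cl Wl) (l + 1) w‖ ≤ ∏ i, (‖Cl (w i).1‖ * ‖Wl (w i).2‖)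
  | 0, w => by
      rw [bprod_one, Fin.prod_univ_one, letter]
      exact Matrix.linfty_opNorm_mul _ _
  | l + 1, w => by
      rw [bprod_succ, Fin.prod_univ_succ]
      calc ‖letter Cl Wl (w 0) * bprod (letter Cl Wl) (l + 1) (Fin.tail w)‖
          ≤ ‖letter Cl Wl (w 0)‖ * ‖bprod (letter Cl Wl) (l + 1) (Fin.tail w)‖ := Matrix.linfty_opNorm_mul _ _
        _ ≤ (‖Cl (w 0).1‖ * ‖Wl (w 0).2‖) * ∏ i : Fin (l + 1), (‖Cl (w i.succ).1‖ * ‖Wl (w i.succ).2‖) :=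
            mul_le_mul (Matrix.linfty_opNorm_mul _ _) (norm_bprod_le l (Fin.tail w)) (norm_nonneg _)
              (mul_nonneg (norm_nonneg _) (norm_nonneg _))

omit [Fintype ι] [Fintype A] [DecidableEq A] [Fintype B] [DecidableEq B] in
/-- indicator of a union ≤ sum of indicators: a word linked from a non-empty cube set `Z` is linked from one of the cubes
of `Z`. [folklore] -/
private theorem ite_linkedFrom_le_sum {Z : Finset ι} (hZ : Z.Nonempty) {v : ℝ} (hv : 0 ≤ v) :
    ∀ (l : ℕ) (w : Fin l → A × B),
      (if LinkedFrom sC sW Z l w then v else 0) ≤ ∑ c ∈ Z, (if LinkedFrom sC sW {c} l w then v else 0)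
  | 0, w => by
      simp only [LinkedFrom, if_true, Finset.sum_const, nsmul_eq_mul]
      have : (1 : ℝ) ≤ Z.card := by exact_mod_cast Finset.card_pos.2 hZ
      nlinarith
  | l + 1, w => by
      by_cases h : LinkedFrom sC sW Z (l + 1) w
      · rw [if_pos h]
        obtain ⟨⟨c, hc⟩, h2, h3⟩ := h
        rw [Finset.mem_inter] at hc
        have hc' : LinkedFrom sC sW {c} (l + 1) w :=
          ⟨⟨c, Finset.mem_inter.2 ⟨Finset.mem_singleton_self c, hc.2⟩⟩, h2, h3⟩
        calc v = (if LinkedFrom sC sW {c} (l + 1) w then v else 0) := by rw [if_pos hc']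
          _ ≤ ∑ c ∈ Z, (if LinkedFrom sC sW {c} (l + 1) w then v else 0) :=
              Finset.single_le_sum (f := fun c => if LinkedFrom sC sW {c} (l + 1) w then v else 0)
                (fun c _ => ite_nonneg hv le_rfl) hc.1
      · rw [if_neg h]
        exact Finset.sum_nonneg fun c _ => ite_nonneg hv le_rfl

omit [Fintype ι] in
/-- the pieces meeting `Y` are among the pieces through the cubes of `Y`: for `h ≥ 0`,
`Σ_{b : Y ∩ s b ≠ ∅} h b ≤ Σ_{c ∈ Y} Σ_{b : c ∈ s b} h b`. [folklore] -/
private theorem sum_meet_le_sum_rooted {K : Type*} [Fintype K] (sK : K → Finset ι) (Y : Finset ι) {h : K → ℝ}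
    (hh : ∀ b, 0 ≤ h b) :
    ∑ b, (if (Y ∩ sK b).Nonempty then h b else 0) ≤ ∑ c ∈ Y, ∑ b, (if c ∈ sK b then h b else 0) := by
  rw [Finset.sum_comm]
  refine Finset.sum_le_sum fun b _ => ?_
  by_cases hb : (Y ∩ sK b).Nonempty
  · rw [if_pos hb]
    obtain ⟨c, hc⟩ := hb
    rw [Finset.mem_inter] at hc
    calc h b = (if c ∈ sK b then h b else 0) := by rw [if_pos hc.2]
      _ ≤ ∑ c ∈ Y, (if c ∈ sK b then h b else 0) :=
          Finset.single_le_sum (f := fun c => if c ∈ sK b then h b else 0) (fun c _ => ite_nonneg (hh b) le_rfl) hc.1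
  · rw [if_neg hb]
    exact Finset.sum_nonneg fun c _ => ite_nonneg (hh b) le_rfl

omit [Fintype ι] [DecidableEq A] [DecidableEq B] in
/-- **THE ROOTED LINKED-CHAIN SUM** — *"all but one such summation is controlled by exponential decay on the j-th scale"*:
for non-negative letter weights `f`, `g` with ROOTED SUMS `Σ_{a : c ∈ sC a} f(a)·|sC a| ≤ N_C` and
`Σ_{b : c ∈ sW b} g(b)·|sW b| ≤ N_W` at every cube `c`, the sum over ALL words of length `l` linked from a given cube of
`Π_i f(a_i)g(b_i)` is at most `(N_C·N_W)^l`: the first letter is summed through the root, and each further letter through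
one of the cubes of the previous support, whose number is the factor `|support|`.
[cite: BalabanImbrieJaffe1988, (5.7.9) p.291] -/
theorem sum_linkedFrom_le {f : A → ℝ} {g : B → ℝ} (hf : ∀ a, 0 ≤ f a) (hg : ∀ b, 0 ≤ g b) {NC NW : ℝ}
    (hNC : ∀ c : ι, ∑ a, (if c ∈ sC a then f a * (sC a).card else 0) ≤ NC)
    (hNW : ∀ c : ι, ∑ b, (if c ∈ sW b then g b * (sW b).card else 0) ≤ NW) :
    ∀ (l : ℕ) (c : ι), ∑ w : Fin l → A × B,
      (if LinkedFrom sC sW {c} l w then ∏ i, (f (w i).1 * g (w i).2) else 0) ≤ (NC * NW) ^ l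
  | 0, c => by simp [LinkedFrom]
  | l + 1, c => by
      have IH := sum_linkedFrom_le hf hg hNC hNW l
      have hP0 : ∀ w : Fin l → A × B, 0 ≤ ∏ i, (f (w i).1 * g (w i).2) :=
        fun w => Finset.prod_nonneg fun i _ => mul_nonneg (hf _) (hg _)
      have hpow : 0 ≤ (NC * NW) ^ l := by
        rcases Nat.eq_zero_or_pos l with rfl | hl
        · simp
        · obtain ⟨c₀⟩ : Nonempty ι := ⟨c⟩
          exact le_trans (Finset.sum_nonneg fun w _ => ite_nonneg (hP0 w) le_rfl) (IH c₀)
      -- the words of length `l + 1` as (first pair, rest)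
      rw [sum_tuple_succ]
      simp only [linkedFrom_cons, Fin.prod_univ_succ, Fin.cons_zero, Fin.cons_succ]
      -- inner sum over the rest of the word, for a fixed first pair `p`
      have step1 : ∀ p : A × B,
          (∑ w : Fin l → A × B,
            (if (({c} : Finset ι) ∩ sC p.1).Nonempty ∧ (sC p.1 ∩ sW p.2).Nonempty ∧ LinkedFrom sC sW (sW p.2) l w
              then f p.1 * g p.2 * ∏ i, (f (w i).1 * g (w i).2) else 0)) ≤
          (if c ∈ sC p.1 then f p.1 else 0) *
            ((if (sC p.1 ∩ sW p.2).Nonempty then g p.2 * (sW p.2).card else 0) * (NC * NW) ^ l) := by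
        intro p
        by_cases hp : c ∈ sC p.1 ∧ (sC p.1 ∩ sW p.2).Nonempty
        · rw [if_pos hp.1, if_pos hp.2]
          have hZ : (sW p.2).Nonempty := let ⟨d, hd⟩ := hp.2; ⟨d, (Finset.mem_inter.1 hd).2⟩
          have h1 : (({c} : Finset ι) ∩ sC p.1).Nonempty :=
            ⟨c, Finset.mem_inter.2 ⟨Finset.mem_singleton_self c, hp.1⟩⟩
          calc (∑ w : Fin l → A × B,
                (if (({c} : Finset ι) ∩ sC p.1).Nonempty ∧ (sC p.1 ∩ sW p.2).Nonempty ∧ LinkedFrom sC sW (sW p.2) l w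
                  then f p.1 * g p.2 * ∏ i, (f (w i).1 * g (w i).2) else 0))
              = f p.1 * g p.2 * ∑ w : Fin l → A × B,
                  (if LinkedFrom sC sW (sW p.2) l w then ∏ i, (f (w i).1 * g (w i).2) else 0) := by
                rw [Finset.mul_sum]
                refine Finset.sum_congr rfl fun w _ => ?_
                by_cases hw : LinkedFrom sC sW (sW p.2) l w
                · rw [if_pos ⟨h1, hp.2, hw⟩, if_pos hw]
                · rw [if_neg (fun h => hw h.2.2), if_neg hw, mul_zero]
            _ ≤ f p.1 * g p.2 * ∑ w : Fin l → A × B, ∑ d ∈ sW p.2,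
                  (if LinkedFrom sC sW {d} l w then ∏ i, (f (w i).1 * g (w i).2) else 0) :=
                mul_le_mul_of_nonneg_left (Finset.sum_le_sum fun w _ => ite_linkedFrom_le_sum hZ (hP0 w) l w)
                  (mul_nonneg (hf _) (hg _))
            _ = f p.1 * g p.2 * ∑ d ∈ sW p.2, ∑ w : Fin l → A × B,
                  (if LinkedFrom sC sW {d} l w then ∏ i, (f (w i).1 * g (w i).2) else 0) := by
                rw [Finset.sum_comm]
            _ ≤ f p.1 * g p.2 * ∑ d ∈ sW p.2, (NC * NW) ^ l :=
                mul_le_mul_of_nonneg_left (Finset.sum_le_sum fun d _ => IH d) (mul_nonneg (hf _) (hg _))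
            _ = f p.1 * ((g p.2 * (sW p.2).card) * (NC * NW) ^ l) := by
                rw [Finset.sum_const, nsmul_eq_mul]; ring
        · have hzero : ∀ w : Fin l → A × B,
              (if (({c} : Finset ι) ∩ sC p.1).Nonempty ∧ (sC p.1 ∩ sW p.2).Nonempty ∧ LinkedFrom sC sW (sW p.2) l w
                then f p.1 * g p.2 * ∏ i, (f (w i).1 * g (w i).2) else 0) = 0 := by
            intro w
            rw [if_neg]
            rintro ⟨⟨d, hd⟩, h2, -⟩
            rw [Finset.mem_inter, Finset.mem_singleton] at hd
            exact hp ⟨hd.1 ▸ hd.2, h2⟩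
          rw [Finset.sum_congr rfl fun w _ => hzero w, Finset.sum_const_zero]
          exact mul_nonneg (ite_nonneg (hf _) le_rfl) (mul_nonneg (ite_nonneg (mul_nonneg (hg _) (Nat.cast_nonneg _)) le_rfl) hpow)
      -- sum over the first pair
      have step2 : ∀ a : A, (∑ b, (if (sC a ∩ sW b).Nonempty then g b * (sW b).card else 0)) ≤ (sC a).card * NW := by
        intro a
        calc (∑ b, (if (sC a ∩ sW b).Nonempty then g b * (sW b).card else 0))
            ≤ ∑ d ∈ sC a, ∑ b, (if d ∈ sW b then g b * (sW b).card else 0) :=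
              sum_meet_le_sum_rooted sW (sC a) fun b => mul_nonneg (hg b) (Nat.cast_nonneg _)
          _ ≤ ∑ d ∈ sC a, NW := Finset.sum_le_sum fun d _ => hNW d
          _ = (sC a).card * NW := by rw [Finset.sum_const, nsmul_eq_mul]
      have hNW0 : 0 ≤ NW :=
        le_trans (Finset.sum_nonneg fun b _ => ite_nonneg (mul_nonneg (hg b) (Nat.cast_nonneg _)) le_rfl) (hNW c)
      calc (∑ p : A × B, ∑ w : Fin l → A × B,
            (if (({c} : Finset ι) ∩ sC p.1).Nonempty ∧ (sC p.1 ∩ sW p.2).Nonempty ∧ LinkedFrom sC sW (sW p.2) l w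
              then f p.1 * g p.2 * ∏ i, (f (w i).1 * g (w i).2) else 0))
          ≤ ∑ p : A × B, (if c ∈ sC p.1 then f p.1 else 0) *
              ((if (sC p.1 ∩ sW p.2).Nonempty then g p.2 * (sW p.2).card else 0) * (NC * NW) ^ l) :=
            Finset.sum_le_sum fun p _ => step1 p
        _ = (∑ a, (if c ∈ sC a then f a else 0) *
              ∑ b, (if (sC a ∩ sW b).Nonempty then g b * (sW b).card else 0)) * (NC * NW) ^ l := by
            rw [Fintype.sum_prod_type, Finset.sum_mul]
            refine Finset.sum_congr rfl fun a _ => ?_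
            rw [Finset.mul_sum, Finset.sum_mul]
            exact Finset.sum_congr rfl fun b _ => by ring
        _ ≤ (∑ a, (if c ∈ sC a then f a else 0) * ((sC a).card * NW)) * (NC * NW) ^ l :=
            mul_le_mul_of_nonneg_right
              (Finset.sum_le_sum fun a _ => mul_le_mul_of_nonneg_left (step2 a) (ite_nonneg (hf a) le_rfl)) hpow
        _ = (∑ a, (if c ∈ sC a then f a * (sC a).card else 0)) * NW * (NC * NW) ^ l := by
            have hsum : (∑ a, (if c ∈ sC a then f a else 0) * ((sC a).card * NW)) =
                (∑ a, (if c ∈ sC a then f a * (sC a).card else 0)) * NW := by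
              rw [Finset.sum_mul]
              refine Finset.sum_congr rfl fun a _ => ?_
              split_ifs <;> ring
            rw [hsum]
        _ ≤ NC * NW * (NC * NW) ^ l :=
            mul_le_mul_of_nonneg_right (mul_le_mul_of_nonneg_right (hNC c) hNW0) hpow
        _ = (NC * NW) ^ (l + 1) := by ring

omit [Fintype ι] [DecidableEq A] [DecidableEq B] in
/-- **THE DECAY IN `|X|` AND THE ROOTED SUM, COMBINED**: for non-negative letter weights `u`, `v` and `κ ≥ 0`, with the
`κ`-WEIGHTED rooted sums `Σ_{a : c ∈ sC a} u(a)e^{κ|sC a|}|sC a| ≤ N_C`, `Σ_{b : c ∈ sW b} v(b)e^{κ|sW b|}|sW b| ≤ N_W`, the words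
of length `l` with hull EXACTLY `X` linked from a cube `c` carry `Σ Π_i u(a_i)v(b_i) ≤ e^{−κ|X|}(N_C N_W)^l` — since
`|X| ≤ Σ_i (|sC a_i| + |sW b_i|)` (`card_hull_le`). [cite: BalabanImbrieJaffe1988, (5.7.9) p.291] -/
theorem sum_hull_linkedFrom_le {u : A → ℝ} {v : B → ℝ} (hu : ∀ a, 0 ≤ u a) (hv : ∀ b, 0 ≤ v b) {κ : ℝ} (hκ : 0 ≤ κ)
    {NC NW : ℝ}
    (hNC : ∀ c : ι, ∑ a, (if c ∈ sC a then u a * Real.exp (κ * (sC a).card) * (sC a).card else 0) ≤ NC)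
    (hNW : ∀ c : ι, ∑ b, (if c ∈ sW b then v b * Real.exp (κ * (sW b).card) * (sW b).card else 0) ≤ NW)
    (l : ℕ) (c : ι) (X : Finset ι) :
    ∑ w : Fin l → A × B, (if hull sC sW l w = X ∧ LinkedFrom sC sW {c} l w then ∏ i, (u (w i).1 * v (w i).2) else 0)
      ≤ Real.exp (-(κ * X.card)) * (NC * NW) ^ l := by
  have key := sum_linkedFrom_le (sC := sC) (sW := sW) (f := fun a => u a * Real.exp (κ * (sC a).card))
    (g := fun b => v b * Real.exp (κ * (sW b).card)) (fun a => mul_nonneg (hu a) (Real.exp_nonneg _))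
    (fun b => mul_nonneg (hv b) (Real.exp_nonneg _)) hNC hNW l c
  rw [← div_le_iff₀' (Real.exp_pos _), Finset.sum_div]
  refine le_trans (Finset.sum_le_sum fun w _ => ?_) key
  by_cases hw : hull sC sW l w = X ∧ LinkedFrom sC sW {c} l w
  · rw [if_pos hw, if_pos hw.2, div_le_iff₀' (Real.exp_pos _)]
    -- e^{-κ|X|} Π (u e^{κ|Y|})(v e^{κ|Z|}) ≥ Π u v  since  |X| ≤ Σ (|Y_i| + |Z_i|)
    have hcard : (X.card : ℝ) ≤ ∑ i, (((sC (w i).1).card : ℝ) + (sW (w i).2).card) := by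
      rw [← hw.1]; exact_mod_cast card_hull_le sC sW l w
    have hexp : Real.exp (κ * X.card) ≤ ∏ i, (Real.exp (κ * (sC (w i).1).card) * Real.exp (κ * (sW (w i).2).card)) := by
      have hprod : ∏ i, (Real.exp (κ * (sC (w i).1).card) * Real.exp (κ * (sW (w i).2).card)) =
          Real.exp (∑ i, (κ * (sC (w i).1).card + κ * (sW (w i).2).card)) := by
        rw [Real.exp_sum]
        exact Finset.prod_congr rfl fun i _ => (Real.exp_add _ _).symm
      rw [hprod, Real.exp_le_exp]
      calc κ * X.card ≤ κ * ∑ i, (((sC (w i).1).card : ℝ) + (sW (w i).2).card) := mul_le_mul_of_nonneg_left hcard hκ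
        _ = ∑ i, (κ * (sC (w i).1).card + κ * (sW (w i).2).card) := by
            rw [Finset.mul_sum]
            exact Finset.sum_congr rfl fun i _ => by ring
    calc ∏ i, (u (w i).1 * v (w i).2)
        = (∏ i, (u (w i).1 * v (w i).2)) * 1 := (mul_one _).symm
      _ ≤ (∏ i, (u (w i).1 * v (w i).2)) * (Real.exp (-(κ * X.card)) * Real.exp (κ * X.card)) := by
          rw [← Real.exp_add, neg_add_cancel, Real.exp_zero]
      _ = Real.exp (-(κ * X.card)) * ((∏ i, (u (w i).1 * v (w i).2)) * Real.exp (κ * X.card)) := by ring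
      _ ≤ Real.exp (-(κ * X.card)) * ((∏ i, (u (w i).1 * v (w i).2)) *
            ∏ i, (Real.exp (κ * (sC (w i).1).card) * Real.exp (κ * (sW (w i).2).card))) :=
          mul_le_mul_of_nonneg_left (mul_le_mul_of_nonneg_left hexp
            (Finset.prod_nonneg fun i _ => mul_nonneg (hu _) (hv _))) (Real.exp_nonneg _)
      _ = Real.exp (-(κ * X.card)) * ∏ i, (u (w i).1 * Real.exp (κ * (sC (w i).1).card) *
            (v (w i).2 * Real.exp (κ * (sW (w i).2).card))) := by
          rw [← Finset.prod_mul_distrib]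
          exact congrArg _ (Finset.prod_congr rfl fun i _ => by ring)
  · rw [if_neg hw, zero_div]
    exact ite_nonneg (Finset.prod_nonneg fun i _ => mul_nonneg (mul_nonneg (hu _) (Real.exp_nonneg _))
      (mul_nonneg (hv _) (Real.exp_nonneg _))) le_rfl

omit [DecidableEq T] [Fintype ι] [Fintype A] [DecidableEq A] [Fintype B] [DecidableEq B] in
/-- the sites of `X`: at most `s` per cube. [folklore] -/
private theorem card_sites_le (cube : T → ι) {s : ℕ} (hs : ∀ c : ι, (Finset.univ.filter fun x => cube x = c).card ≤ s)
    (X : Finset ι) : ((Finset.univ.filter fun x : T => cube x ∈ X).card : ℝ) ≤ s * X.card := by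
  classical
  have h := Finset.card_eq_sum_card_fiberwise (s := Finset.univ.filter fun x : T => cube x ∈ X) (t := X) (f := cube)
    (fun x hx => (Finset.mem_filter.1 hx).2)
  rw [h]
  push_cast
  calc (∑ c ∈ X, (((Finset.univ.filter fun x : T => cube x ∈ X).filter fun x => cube x = c).card : ℝ))
      ≤ ∑ c ∈ X, (s : ℝ) := Finset.sum_le_sum fun c _ => by
        exact_mod_cast le_trans (Finset.card_le_card (fun x hx => by
          rw [Finset.mem_filter] at hx ⊢; exact ⟨Finset.mem_univ _, hx.2⟩)) (hs c)
    _ = s * X.card := by rw [Finset.sum_const, nsmul_eq_mul, mul_comm]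

omit [Fintype ι] [DecidableEq A] [DecidableEq B] in
/-- **ONE FREE SUMMATION** — *"This is to account for one free summation on T₁^{(j)}"*: if every selected word `w` of length
`l ≥ 1` has `‖C_{a₁}W_{b₁}⋯‖ ≤ F(w)` (`F ≥ 0`), and the words with hull `X` linked from any cube of `X` carry
`Σ F ≤ M`, then `|wlen l S X| ≤ s·|X|·M` — the trace costs the number of sites of `X`, at most `s` per cube
(`|tr K| ≤ Σ_x |K(x,x)|`, `|K(x,x)| ≤ ‖K‖`, and a non-zero `K(x,x)` roots the word at the cube of `x`).
[cite: BalabanImbrieJaffe1988, (5.7.9) p.291] -/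
theorem abs_wlen_le_of_majorant
    (hCs : ∀ a x y, Cl a x y ≠ 0 → cube x ∈ sC a ∧ cube y ∈ sC a)
    (hWs : ∀ b x y, Wl b x y ≠ 0 → cube x ∈ sW b ∧ cube y ∈ sW b)
    {s : ℕ} (hs : ∀ c : ι, (Finset.univ.filter fun x => cube x = c).card ≤ s)
    (l : ℕ) (S : (Fin (l + 1) → A × B) → Prop) [DecidablePred S] (X : Finset ι)
    {F : (Fin (l + 1) → A × B) → ℝ} (hF0 : ∀ w, 0 ≤ F w) (hF : ∀ w, S w → ‖bprod (letter Cl Wl) (l + 1) w‖ ≤ F w)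
    {M : ℝ} (hM : 0 ≤ M)
    (hroot : ∀ x, cube x ∈ X → ∑ w : Fin (l + 1) → A × B,
      (if hull sC sW (l + 1) w = X ∧ LinkedFrom sC sW {cube x} (l + 1) w then F w else 0) ≤ M) :
    |wlen Cl sC Wl sW (l + 1) S X| ≤ s * X.card * M := by
  classical
  unfold wlen
  set Φ := Finset.univ.filter (fun w : Fin (l + 1) → A × B => hull sC sW (l + 1) w = X ∧ S w) with hΦ
  -- |Σ tr| ≤ Σ_x Σ_w |K_w(x,x)|
  have h1 : |∑ w ∈ Φ, (bprod (letter Cl Wl) (l + 1) w).trace| ≤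
      ∑ x, ∑ w ∈ Φ, |(bprod (letter Cl Wl) (l + 1) w) x x| := by
    rw [Finset.sum_comm]
    refine (Finset.abs_sum_le_sum_abs _ _).trans (Finset.sum_le_sum fun w _ => ?_)
    exact Finset.abs_sum_le_sum_abs _ _
  -- each site: ≤ [cube x ∈ X]·M
  have h2 : ∀ x, ∑ w ∈ Φ, |(bprod (letter Cl Wl) (l + 1) w) x x| ≤ if cube x ∈ X then M else 0 := by
    intro x
    by_cases hx : cube x ∈ X
    · rw [if_pos hx]
      refine le_trans ?_ (hroot x hx)
      rw [← Finset.sum_filter_add_sum_filter_not Finset.univ (fun w => w ∈ Φ)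
        (fun w => if hull sC sW (l + 1) w = X ∧ LinkedFrom sC sW {cube x} (l + 1) w then F w else 0)]
      have hΦ' : Finset.univ.filter (fun w => w ∈ Φ) = Φ := by ext w; simp
      rw [hΦ']
      refine le_trans (Finset.sum_le_sum fun w hw => ?_)
        (le_add_of_nonneg_right (Finset.sum_nonneg fun w _ => ite_nonneg (hF0 w) le_rfl))
      rw [hΦ, Finset.mem_filter] at hw
      by_cases hne : (bprod (letter Cl Wl) (l + 1) w) x x = 0
      · rw [hne, abs_zero]; exact ite_nonneg (hF0 w) le_rfl
      · rw [if_pos ⟨hw.2.1, linkedFrom_of_bprod_apply_ne_zero hCs hWs (l + 1) w hne⟩]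
        exact (abs_apply_le_norm _ _ _).trans (hF w hw.2.2)
    · rw [if_neg hx]
      refine (Finset.sum_eq_zero fun w hw => ?_).le
      rw [hΦ, Finset.mem_filter] at hw
      by_contra hne
      rw [abs_eq_zero] at hne
      exact hx (hw.2.1 ▸ cube_mem_hull_of_bprod_apply_ne_zero hCs l w hne)
  -- the number of sites of X
  have h3 : (∑ x : T, (if cube x ∈ X then M else 0)) ≤ s * X.card * M := by
    rw [← Finset.sum_filter, Finset.sum_const, nsmul_eq_mul]
    exact mul_le_mul_of_nonneg_right (card_sites_le cube hs X) hM
  exact h1.trans ((Finset.sum_le_sum fun x _ => h2 x).trans h3)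

omit [Fintype ι] [DecidableEq A] [DecidableEq B] in
/-- **THE FIRST INEQUALITY OF (5.7.9), PER LENGTH** — for every selection `S`, every cube set `X` and every `κ ≥ 0`:
`|wlen l S X| ≤ s·|X|·(N_κ(C)·N_κ(W))^l·e^{−κ|X|}`, where `s` bounds the sites per cube (print: `(r(e_k)L^{k−j})^d`) and
`N_κ(C) ≥ Σ_{a : c ∈ sC a} ‖C_a‖e^{κ|sC a|}|sC a|`, `N_κ(W) ≥ Σ_{b : c ∈ sW b} ‖W_b‖e^{κ|sW b|}|sW b|` are the rooted sums of
the two letter families — EXACTLY ONE volume factor `s|X|`, everything else *"controlled by exponential decay"*.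
[cite: BalabanImbrieJaffe1988, (5.7.9) p.291] -/
theorem abs_wlen_le
    (hCs : ∀ a x y, Cl a x y ≠ 0 → cube x ∈ sC a ∧ cube y ∈ sC a)
    (hWs : ∀ b x y, Wl b x y ≠ 0 → cube x ∈ sW b ∧ cube y ∈ sW b)
    {s : ℕ} (hs : ∀ c : ι, (Finset.univ.filter fun x => cube x = c).card ≤ s)
    {κ : ℝ} (hκ : 0 ≤ κ) {NC NW : ℝ}
    (hNC : ∀ c : ι, ∑ a, (if c ∈ sC a then ‖Cl a‖ * Real.exp (κ * (sC a).card) * (sC a).card else 0) ≤ NC)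
    (hNW : ∀ c : ι, ∑ b, (if c ∈ sW b then ‖Wl b‖ * Real.exp (κ * (sW b).card) * (sW b).card else 0) ≤ NW)
    (l : ℕ) (S : (Fin (l + 1) → A × B) → Prop) [DecidablePred S] (X : Finset ι) :
    |wlen Cl sC Wl sW (l + 1) S X| ≤ s * X.card * (Real.exp (-(κ * X.card)) * (NC * NW) ^ (l + 1)) := by
  rcases X.eq_empty_or_nonempty with rfl | ⟨c₀, -⟩
  · -- X = ∅: the only word with empty hull has all supports empty, hence zero letters; but simpler: s*0*… = 0 and
    -- wlen = 0 since a non-zero trace roots a cube in the hull.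
    have : wlen Cl sC Wl sW (l + 1) S ∅ = 0 := by
      unfold wlen
      refine Finset.sum_eq_zero fun w hw => ?_
      rw [Finset.mem_filter] at hw
      by_contra hne
      obtain ⟨x, -, hx⟩ := Finset.exists_ne_zero_of_sum_ne_zero hne
      have := cube_mem_hull_of_bprod_apply_ne_zero (sW := sW) hCs l w hx
      rw [hw.2.1] at this
      exact Finset.notMem_empty _ this
    rw [this]; simp
  have hNC0 : 0 ≤ NC := le_trans (Finset.sum_nonneg fun a _ => ite_nonneg (mul_nonneg (mul_nonneg (norm_nonneg _)
      (Real.exp_nonneg _)) (Nat.cast_nonneg _)) le_rfl) (hNC c₀)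
  have hNW0 : 0 ≤ NW := le_trans (Finset.sum_nonneg fun b _ => ite_nonneg (mul_nonneg (mul_nonneg (norm_nonneg _)
      (Real.exp_nonneg _)) (Nat.cast_nonneg _)) le_rfl) (hNW c₀)
  refine abs_wlen_le_of_majorant hCs hWs hs l S X (F := fun w => ∏ i, (‖Cl (w i).1‖ * ‖Wl (w i).2‖))
    (fun w => Finset.prod_nonneg fun i _ => mul_nonneg (norm_nonneg _) (norm_nonneg _))
    (fun w _ => norm_bprod_le l w) (mul_nonneg (Real.exp_nonneg _) (pow_nonneg (mul_nonneg hNC0 hNW0) _)) ?_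
  intro x _
  exact sum_hull_linkedFrom_le (fun a => norm_nonneg (Cl a)) (fun b => norm_nonneg (Wl b)) hκ hNC hNW (l + 1) (cube x) X


/-! ### the rooted sums from exponential decay of the pieces (lattice animals) -/

omit [Fintype A] [DecidableEq A] [Fintype B] [DecidableEq B] in
/-- **THE ROOTED SUMS ARE "CONTROLLED BY EXPONENTIAL DECAY"** — how the hypotheses `N_κ` of `abs_wlen_le` are met: if the
pieces are supported in `R`-connected cube sets (for a symmetric cube adjacency `R` of degree `≤ Δ₀`) and the pieces with a
given support `X` weigh in aggregate at most `K·λ^{|X|}` (print: `|C^{(k)}_{Λ,X}| ≤ e^{−c|x₁−x₂|}e^{−cr(e_k)|X|}` (2.46),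
`|W^{(j)}(X)| ≤ e_j^{n̄+1−α}e^{−cr(e_k)|X|^−}` (5.7.7)-block, with boundedly many pieces per support), then for every `κ`
with `(Δ₀+1)²·2λe^κ ≤ ½` the `κ`-weighted rooted sum at every cube is `≤ 4Kλe^κ` — by `|X|(λe^κ)^{|X|} ≤ (2λe^κ)^{|X|}` and the
tree's lattice-animal bound `Σ_{X ∋ c connected} μ^{|X|} ≤ 2μ` (`Literature.Probability.LatticeModels.sum_pow_card_le_of_connected`).
[cite: BalabanImbrieJaffe1988, (2.46) p.265, (5.7.9) p.291] -/
theorem rooted_sum_le_of_decay (R : ι → ι → Prop) (hR : ∀ x y, R x y → R y x) (nbr : ι → Finset ι) {Δ₀ : ℕ}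
    (hΔ₀ : ∀ x, (nbr x).card ≤ Δ₀) (hnbr : ∀ x y, R x y → y ∈ nbr x)
    {P : Type*} [Fintype P] (sP : P → Finset ι) {u : P → ℝ}
    (hconn : ∀ a, u a ≠ 0 → IsRConnected R (sP a))
    {K lam κ : ℝ} (hK : 0 ≤ K) (hlam : 0 ≤ lam)
    (hagg : ∀ X : Finset ι, ∑ a ∈ Finset.univ.filter (fun a => sP a = X), u a ≤ K * lam ^ X.card)
    (hsmall : ((Δ₀ : ℝ) + 1) ^ 2 * (2 * (lam * Real.exp κ)) ≤ 1 / 2) (c : ι) :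
    ∑ a, (if c ∈ sP a then u a * Real.exp (κ * (sP a).card) * (sP a).card else 0) ≤ 4 * K * (lam * Real.exp κ) := by
  classical
  set μ : ℝ := lam * Real.exp κ with hμ
  have hμ0 : 0 ≤ μ := mul_nonneg hlam (Real.exp_nonneg κ)
  -- e^{κ|X|}·λ^{|X|} = μ^{|X|}
  have hexp : ∀ n : ℕ, lam ^ n * Real.exp (κ * n) = μ ^ n := by
    intro n
    rw [hμ, mul_pow, mul_comm κ, Real.exp_nat_mul]
  -- group the pieces by their support
  rw [← Finset.sum_fiberwise Finset.univ sP
    (fun a => if c ∈ sP a then u a * Real.exp (κ * (sP a).card) * (sP a).card else 0)]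
  -- each support `X` contributes at most `[c ∈ X, X connected]·K|X|μ^{|X|}`
  have hX : ∀ X : Finset ι,
      (∑ a ∈ Finset.univ.filter (fun a => sP a = X),
        (if c ∈ sP a then u a * Real.exp (κ * (sP a).card) * (sP a).card else 0)) ≤
      (if c ∈ X ∧ IsRConnected R X then K * ((X.card : ℝ) * μ ^ X.card) else 0) := by
    intro X
    have hrw : (∑ a ∈ Finset.univ.filter (fun a => sP a = X),
        (if c ∈ sP a then u a * Real.exp (κ * (sP a).card) * (sP a).card else 0)) =
        (if c ∈ X then Real.exp (κ * X.card) * X.card * ∑ a ∈ Finset.univ.filter (fun a => sP a = X), u a else 0) := by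
      rw [Finset.mul_sum]
      by_cases hc : c ∈ X
      · rw [if_pos hc]
        refine Finset.sum_congr rfl fun a ha => ?_
        rw [Finset.mem_filter] at ha
        rw [ha.2, if_pos hc]; ring
      · rw [if_neg hc]
        refine Finset.sum_eq_zero fun a ha => ?_
        rw [Finset.mem_filter] at ha
        rw [ha.2, if_neg hc]
    rw [hrw]
    by_cases hc : c ∈ X
    · rw [if_pos hc]
      by_cases hz : ∑ a ∈ Finset.univ.filter (fun a => sP a = X), u a = 0
      · rw [hz, mul_zero]
        exact ite_nonneg (mul_nonneg hK (mul_nonneg (Nat.cast_nonneg _) (pow_nonneg hμ0 _))) le_rfl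
      · obtain ⟨a, ha, hua⟩ := Finset.exists_ne_zero_of_sum_ne_zero hz
        rw [Finset.mem_filter] at ha
        have hXc : IsRConnected R X := ha.2 ▸ hconn a hua
        rw [if_pos ⟨hc, hXc⟩]
        calc Real.exp (κ * X.card) * X.card * ∑ a ∈ Finset.univ.filter (fun a => sP a = X), u a
            ≤ Real.exp (κ * X.card) * X.card * (K * lam ^ X.card) :=
              mul_le_mul_of_nonneg_left (hagg X) (by positivity)
          _ = K * (X.card * (lam ^ X.card * Real.exp (κ * X.card))) := by ring
          _ = K * (X.card * μ ^ X.card) := by rw [hexp]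
    · rw [if_neg hc, if_neg (fun h => hc h.1)]
  refine (Finset.sum_le_sum fun X _ => hX X).trans ?_
  rw [← Finset.sum_filter, ← Finset.mul_sum]
  -- |X| μ^{|X|} ≤ (2μ)^{|X|} and the animal sum
  have hanimal : ∑ X ∈ Finset.univ.filter (fun X : Finset ι => c ∈ X ∧ IsRConnected R X),
      ((X.card : ℝ) * μ ^ X.card) ≤ 2 * (2 * μ) := by
    calc ∑ X ∈ Finset.univ.filter (fun X : Finset ι => c ∈ X ∧ IsRConnected R X), ((X.card : ℝ) * μ ^ X.card)
        ≤ ∑ X ∈ Finset.univ.filter (fun X : Finset ι => c ∈ X ∧ IsRConnected R X), (2 * μ) ^ X.card := by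
          refine Finset.sum_le_sum fun X _ => ?_
          have h2 : (X.card : ℝ) ≤ (2 : ℝ) ^ X.card := by exact_mod_cast X.card.lt_two_pow_self.le
          calc (X.card : ℝ) * μ ^ X.card ≤ (2 : ℝ) ^ X.card * μ ^ X.card :=
              mul_le_mul_of_nonneg_right h2 (pow_nonneg hμ0 _)
            _ = (2 * μ) ^ X.card := (mul_pow 2 μ X.card).symm
      _ ≤ 2 * (2 * μ) :=
          Literature.Probability.LatticeModels.sum_pow_card_le_of_connected hR hΔ₀ hnbr (by positivity)
            (by simpa [hμ] using hsmall) c _ fun X hX => (Finset.mem_filter.mp hX).2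
  calc K * ∑ X ∈ Finset.univ.filter (fun X : Finset ι => c ∈ X ∧ IsRConnected R X), ((X.card : ℝ) * μ ^ X.card)
      ≤ K * (2 * (2 * μ)) := mul_le_mul_of_nonneg_left hanimal hK
    _ = 4 * K * (lam * Real.exp κ) := by rw [hμ]; ring

end Mechanism

end Literature.MathematicalPhysics.QuantumFieldTheory.BalabanImbrieJaffe1984to88.BIJ88TraceTermsBound579
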